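import Mathlib
import Summits.AtomisticToContinuum.Crystallization.Theses.PhononSlackCertificates
import Summits.AtomisticToContinuum.Crystallization.Theorems.PhononSlackCertificatesNearFieldConvexityStubCruxOfPureNearField
import Summits.AtomisticToContinuum.Crystallization.Theorems.PhononSlackCertificatesNearFieldConvexityStubInterfaceOfPairCount
import Summits.AtomisticToContinuum.Crystallization.Theorems.PhononSlackCertificatesNearFieldConvexityStubPairCountOfCrossing
import Summits.AtomisticToContinuum.Crystallization.Theorems.PhononSlackCertificatesNearFieldConvexityStubChartSites
import Summits.AtomisticToContinuum.Crystallization.Theorems.PhononSlackCertificatesNearFieldConvexityStubChartCoverage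
import Summits.AtomisticToContinuum.Crystallization.Theorems.PricedLinkCensusSoftLayerPropagationBasics

/-!
# The crux `NearFieldConvexity` in the COARSE regime `η ≥ 2/5`, given the chart core
(crux `PhononSlackCertificates.NearFieldConvexity`, stmt-AtomisticToContinuum-13958, line `Sketch`, lead c4)

The crux asks, for EVERY tolerance `η > 0`, for constants `c > 0`, `C` with
`c·#{i ∈ Ω : B(x i, 2) not η-layered} − C·#∂₄Ω ≤ Σ_{i∈Ω}(e_i − e*)` over sets `Ω` of 1/20-good particles of
`δ`-separated configurations.  This file proves the statement for all `η ≥ 2/5` MODULO ONLY THE GEOMETRIC STUB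
`stub_chartCore` (taken as a hypothesis, verbatim), with no energy certificate at all:

* `chart_of_stubs_radius` — the chart assembly of the skeleton (`chart_of_stubs`, lead c3) needs goodness on the
  `3`-ball only, so it holds at every particle of `Ω` whose `3`-ball lies in `Ω` (stated for any interior radius
  `ρ ≥ 3`; the skeleton's radius-8 chart is the case `ρ = 8`);
* `layered_of_chart` — a `2/5`-chart IS an `η`-layering of the 2-ball for every `η ≥ 2/5` (translation `t = −x i`,
  uniform heights `z m = m·h`, `(m h) • layerNormal 1 = m • layerNormal h`);
* `stub_coarseRegime` — hence every non-`η`-layered particle of `Ω` has a particle outside `Ω` within `3 ≤ 4`, the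
  non-layered count is at most the boundary count, and the landed boundary floor
  (`boundaryFloor ∘ interfaceLemma`: `Σ_{i∈Ω}(e_i − e*) ≥ −C(δ)·#∂₄Ω`) closes the inequality with `c = 1`,
  `C = 1 + C(δ)`.

So the whole content of the crux left open by the line is the QUANTITATIVE regime `η < 2/5` (indeed `η → 0`, `c ∝ η²`),
which is the registered certificate stub `stub_certificateOnChartsRef`.  The helpers `chart_template_eq`,
`sqrt_six_div_three_mem` are the skeleton's (moved here so that the final skeleton imports them; the scaling
`barlowPos a (a c) s = a • barlowPos 1 c s` is the landed `Theorems.barlowPos_eq_smul`).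
[folklore]
-/

noncomputable section

open scoped BigOperators
open Literature.MathematicalPhysics.StatisticalMechanics Literature.Geometry.DiscreteGeometry

namespace Summit.AtomisticToContinuum.Crystallization.Theorems.PhononSlackNearFieldConvexity

/-- The INTERFACE LEMMA (landed chain: pair count + integer-shell summation), assembled. [folklore] -/
theorem interfaceLemma :
    ∀ δ : ℝ, 0 < δ → ∃ K : ℝ, ∀ (N : ℕ) (x : Fin N → EuclideanSpace ℝ (Fin 3)),
      (∀ i j : Fin N, i ≠ j → δ ≤ dist (x i) (x j)) →
      ∀ Ω : Finset (Fin N), (∀ i ∈ Ω, IsTwoShellGood (1 / 20) (47 / 50) 1 x i) →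
        (∑ i ∈ Ω.filter (fun i => ∀ j : Fin N, dist (x j) (x i) ≤ 4 → j ∈ Ω),
            ∑ j ∈ Finset.univ.filter (fun j => j ∉ Ω), (dist (x i) (x j))⁻¹ ^ 6) ≤
          K * (Nat.card {i : Fin N // i ∈ Ω ∧ ∃ j : Fin N, j ∉ Ω ∧ dist (x j) (x i) ≤ 4} : ℝ) :=
  stub_interfaceOfPairCount stub_pairCountOfCrossing

/-! ### The chart assembly at any interior radius `ρ ≥ 3` -/

/-- The template point of the chart in the centre's frame. [folklore] -/
theorem chart_template_eq (a h₀ : ℝ) (s : ℤ → ℤ) (A R : EuclideanSpace ℝ (Fin 3) →ₗᵢ[ℝ] EuclideanSpace ℝ (Fin 3))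
    (m u v : ℤ) :
    (A.comp R) (((u : ℝ) • triangularVec₁ a) + ((v : ℝ) • triangularVec₂ a) + ((haggLabel s m : ℝ) • barlowOffset a) +
        ((m : ℝ) • layerNormal (a * h₀))) = a • A (R (barlowPos 1 h₀ s m u v)) := by
  show (A.comp R) (barlowPos a (a * h₀) s m u v) = _
  rw [Summit.AtomisticToContinuum.Crystallization.Theorems.barlowPos_eq_smul, LinearIsometry.coe_comp,
    Function.comp_apply, map_smul, map_smul]

/-- `√6 / 3 ∈ [39/50, 17/20]`. [folklore] -/
theorem sqrt_six_div_three_mem : (39 / 50 : ℝ) ≤ Real.sqrt 6 / 3 ∧ Real.sqrt 6 / 3 ≤ 17 / 20 := by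
  have h1 : (117 / 50 : ℝ) ≤ Real.sqrt 6 := by
    rw [show (117 / 50 : ℝ) = Real.sqrt ((117 / 50) ^ 2) by rw [Real.sqrt_sq]; norm_num]
    exact Real.sqrt_le_sqrt (by norm_num)
  have h2 : Real.sqrt 6 ≤ 51 / 20 := by
    rw [show (51 / 20 : ℝ) = Real.sqrt ((51 / 20) ^ 2) by rw [Real.sqrt_sq]; norm_num]
    exact Real.sqrt_le_sqrt (by norm_num)
  constructor <;> linarith

/-- **ASSEMBLY of the chart at interior radius `ρ ≥ 3`: coverage → core → sites → N1** (tolerance `2/5`, scale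
window `[47/50,1]`, spacing window `[39a/50, 17a/20]`).  The skeleton's `chart_of_stubs` verbatim, except that the
interior hypothesis is `dist ≤ ρ → k ∈ Ω` for any `ρ ≥ 3` (only the `3`-ball is used). [folklore] -/
theorem chart_of_stubs_radius {ρ : ℝ} (hρ : 3 ≤ ρ)
    (hcov : ∀ P : Finset (EuclideanSpace ℝ (Fin 3)), (P = fccTwoShellPattern ∨ P = hcpTwoShellPattern) →
      ∀ (A : EuclideanSpace ℝ (Fin 3) →ₗᵢ[ℝ] EuclideanSpace ℝ (Fin 3)) (a : ℝ), 47 / 50 ≤ a → a ≤ 1 →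
        ∀ y : EuclideanSpace ℝ (Fin 3), ‖y‖ ≤ 2 → ∃ v ∈ insert (0 : EuclideanSpace ℝ (Fin 3)) P, ‖y - a • A v‖ ≤ 141 / 100 - a / 20)
    (hcore : ∀ (N : ℕ) (x : Fin N → EuclideanSpace ℝ (Fin 3)) (i : Fin N),
      (∀ k : Fin N, dist (x k) (x i) ≤ 3 → IsTwoShellGood (1 / 20) (47 / 50) 1 x k) →
      ∀ (a : ℝ) (A : EuclideanSpace ℝ (Fin 3) →ₗᵢ[ℝ] EuclideanSpace ℝ (Fin 3)) (P : Finset (EuclideanSpace ℝ (Fin 3))) (f : EuclideanSpace ℝ (Fin 3) → Fin N),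
        47 / 50 ≤ a → a ≤ 1 → (P = fccTwoShellPattern ∨ P = hcpTwoShellPattern) →
        (∀ v ∈ P, f v ≠ i ∧ dist (x (f v)) (x i + a • A v) ≤ 1 / 20 * a) → Set.InjOn f ↑P →
        (∀ j : Fin N, j ≠ i → dist (x j) (x i) ≤ 3 / 2 * a → ∃ v ∈ P, f v = j) →
        ∃ (R : EuclideanSpace ℝ (Fin 3) →ₗᵢ[ℝ] EuclideanSpace ℝ (Fin 3)) (s : ℤ → ℤ), IsHaggSeq s ∧
          (∀ v ∈ P, ∃ m u w : ℤ, R (barlowPos 1 (Real.sqrt 6 / 3) s m u w) = v) ∧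
          (∀ m u w : ℤ, ‖barlowPos 1 (Real.sqrt 6 / 3) s m u w‖ ≤ 3 / 2 → barlowPos 1 (Real.sqrt 6 / 3) s m u w ≠ 0 → R (barlowPos 1 (Real.sqrt 6 / 3) s m u w) ∈ P) ∧
          (∀ v ∈ P, ∀ k : Fin N, dist (x k) (x (f v)) ≤ 141 / 100 → dist (x k) (x i) ≤ 2 →
            ∃ m u w : ℤ, dist (x k) (x i + a • A (R (barlowPos 1 (Real.sqrt 6 / 3) s m u w))) ≤ 2 / 5) ∧
          (∀ v ∈ P, ∀ m u w : ℤ, ‖barlowPos 1 (Real.sqrt 6 / 3) s m u w‖ ≤ 43 / 20 → dist (R (barlowPos 1 (Real.sqrt 6 / 3) s m u w)) v ≤ 3 / 2 →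
            ∃ k : Fin N, dist (x k) (x i + a • A (R (barlowPos 1 (Real.sqrt 6 / 3) s m u w))) ≤ 2 / 5))
    (hsites : ∀ s : ℤ → ℤ, IsHaggSeq s → ∀ m u v : ℤ, ‖barlowPos 1 (Real.sqrt 6 / 3) s m u v‖ ≤ 43 / 20 →
      barlowPos 1 (Real.sqrt 6 / 3) s m u v = 0 ∨
        ∃ m' u' v' : ℤ, 0 < ‖barlowPos 1 (Real.sqrt 6 / 3) s m' u' v'‖ ∧ ‖barlowPos 1 (Real.sqrt 6 / 3) s m' u' v'‖ ≤ 3 / 2 ∧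
          ‖barlowPos 1 (Real.sqrt 6 / 3) s m u v - barlowPos 1 (Real.sqrt 6 / 3) s m' u' v'‖ ≤ 3 / 2) :
    ∀ (N : ℕ) (x : Fin N → EuclideanSpace ℝ (Fin 3)) (Ω : Finset (Fin N)), (∀ i ∈ Ω, IsTwoShellGood (1 / 20) (47 / 50) 1 x i) →
      ∀ i ∈ Ω, (∀ k : Fin N, dist (x k) (x i) ≤ ρ → k ∈ Ω) →
        (∃ (A : EuclideanSpace ℝ (Fin 3) →ₗᵢ[ℝ] EuclideanSpace ℝ (Fin 3)) (a h : ℝ) (s : ℤ → ℤ), 47 / 50 ≤ a ∧ a ≤ 1 ∧ 39 / 50 * a ≤ h ∧ h ≤ 17 / 20 * a ∧ IsHaggSeq s ∧ (fun S : Set (EuclideanSpace ℝ (Fin 3)) => (∀ j : Fin N, dist (x j) (x i) ≤ 2 → ∃ p ∈ S, dist (x j) p ≤ 2 / 5) ∧ (∀ p ∈ S, dist p (x i) ≤ 2 → ∃ j : Fin N, dist (x j) p ≤ 2 / 5)) {p | ∃ m u v : ℤ, p = x i + A (((u : ℝ) • triangularVec₁ a) + ((v : ℝ) • triangularVec₂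 a) + ((haggLabel s m : ℝ) • barlowOffset a) + ((m : ℝ) • layerNormal h))}) := by
  intro N x Ω hΩ i hi hρΩ
  have hgood3 : ∀ k : Fin N, dist (x k) (x i) ≤ 3 → IsTwoShellGood (1 / 20) (47 / 50) 1 x k :=
    fun k hk => hΩ k (hρΩ k (hk.trans hρ))
  obtain ⟨a, ha1, ha2, A, P, f, hP, hf, hinj, hcomp⟩ := hΩ i hi
  obtain ⟨R, s, hs, hc1, hc2, hA, hB⟩ := hcore N x i hgood3 a A P f ha1 ha2 hP hf hinj hcomp
  obtain ⟨h6lo, h6hi⟩ := sqrt_six_div_three_mem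
  have ha0 : 0 < a := by linarith
  refine ⟨A.comp R, a, a * (Real.sqrt 6 / 3), s, ha1, ha2, by nlinarith, by nlinarith, hs, ?_, ?_⟩
  · -- particles within `2` of `x i`
    intro j hj
    have hy : ‖x j - x i‖ ≤ 2 := by rwa [← dist_eq_norm]
    obtain ⟨v, hv, hvy⟩ := hcov P hP A a ha1 ha2 (x j - x i) hy
    rcases Finset.mem_insert.1 hv with rfl | hvP
    · -- covered by the centre itself: `j` is `i` or one of its pattern particles
      have hji : dist (x j) (x i) ≤ 3 / 2 * a := by
        rw [dist_eq_norm]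
        have : ‖x j - x i - a • A (0 : EuclideanSpace ℝ (Fin 3))‖ = ‖x j - x i‖ := by simp
        linarith [this ▸ hvy]
      by_cases hji' : j = i
      · subst hji'
        refine ⟨x j, ⟨0, 0, 0, ?_⟩, by rw [dist_self]; norm_num⟩
        rw [chart_template_eq]
        simp [barlowPos]
      · obtain ⟨w, hw, hfw⟩ := hcomp j hji' hji
        obtain ⟨m, u, w', hRw⟩ := hc1 w hw
        refine ⟨x i + a • A w, ⟨m, u, w', by rw [chart_template_eq, hRw]⟩, ?_⟩
        have := (hf w hw).2
        rw [hfw] at this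
        calc dist (x j) (x i + a • A w) ≤ 1 / 20 * a := this
          _ ≤ 2 / 5 := by linarith
    · -- covered by the pattern neighbour `f v`
      have hd : dist (x j) (x (f v)) ≤ 141 / 100 := by
        calc dist (x j) (x (f v)) ≤ dist (x j) (x i + a • A v) + dist (x i + a • A v) (x (f v)) := dist_triangle _ _ _
          _ ≤ (141 / 100 - a / 20) + 1 / 20 * a := by
              refine add_le_add ?_ ?_
              · rw [dist_eq_norm]
                have : x j - (x i + a • A v) = x j - x i - a • A v := by abel
                rw [this]; exact hvy
              · rw [dist_comm]; exact (hf v hvP).2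
          _ = 141 / 100 := by ring
      obtain ⟨m, u, w, hk⟩ := hA v hvP j hd hj
      exact ⟨_, ⟨m, u, w, by rw [chart_template_eq]⟩, hk⟩
  · -- template points within `2` of `x i`
    rintro p ⟨m, u, v, rfl⟩ hp
    rw [chart_template_eq] at hp ⊢
    have hnorm : ∀ b : EuclideanSpace ℝ (Fin 3), ‖a • A (R b)‖ = a * ‖b‖ := fun b => by
      rw [norm_smul, Real.norm_of_nonneg ha0.le, LinearIsometry.norm_map, LinearIsometry.norm_map]
    have hp' : ‖a • A (R (barlowPos 1 (Real.sqrt 6 / 3) s m u v))‖ ≤ 2 := by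
      have := hp
      rwa [dist_eq_norm, add_sub_cancel_left] at this
    have hb2 : a * ‖barlowPos 1 (Real.sqrt 6 / 3) s m u v‖ ≤ 2 := by rwa [hnorm] at hp'
    have hb : ‖barlowPos 1 (Real.sqrt 6 / 3) s m u v‖ ≤ 43 / 20 := by
      by_contra hcon
      push Not at hcon
      have h1 : (47 / 50 : ℝ) * (43 / 20) ≤ a * (43 / 20) := by nlinarith
      have h2 : a * (43 / 20) < a * ‖barlowPos 1 (Real.sqrt 6 / 3) s m u v‖ := mul_lt_mul_of_pos_left hcon ha0
      linarith
    rcases hsites s hs m u v hb with hb0 | ⟨m', u', v', hpos, hc, hnear⟩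
    · refine ⟨i, ?_⟩
      rw [hb0, map_zero, map_zero, smul_zero, add_zero, dist_self]
      norm_num
    · have hne : barlowPos 1 (Real.sqrt 6 / 3) s m' u' v' ≠ 0 := by
        intro h0; rw [h0, norm_zero] at hpos; exact lt_irrefl _ hpos
      have hcP : R (barlowPos 1 (Real.sqrt 6 / 3) s m' u' v') ∈ P := hc2 m' u' v' hc hne
      have hdist : dist (R (barlowPos 1 (Real.sqrt 6 / 3) s m u v)) (R (barlowPos 1 (Real.sqrt 6 / 3) s m' u' v')) ≤ 3 / 2 := by
        rw [dist_eq_norm, ← map_sub, LinearIsometry.norm_map]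
        exact hnear
      obtain ⟨k, hk⟩ := hB _ hcP m u v hb hdist
      exact ⟨k, hk⟩

/-! ### A `2/5`-chart is an `η`-layering for every `η ≥ 2/5` -/

/-- Heights: `(c·h) • layerNormal 1 = c • layerNormal h`. [folklore] -/
theorem mul_smul_layerNormal_one (c h : ℝ) : (c * h) • layerNormal 1 = c • layerNormal h := by
  ext l
  fin_cases l <;> simp [layerNormal]

/-- **Chart ⇒ layered (`η ≥ 2/5`).**  A two-way `2/5`-matching of the `2`-ball of `x i` with the shifted
template `x i + A(sites of (a, s) at uniform height h)`, `(a, h)` in the window, is an `η`-layering of the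
`2`-ball in the sense of the crux (translation `t = −x i`, heights `z m = m h`) for every `η ≥ 2/5`. [folklore] -/
theorem layered_of_chart {N : ℕ} (x : Fin N → EuclideanSpace ℝ (Fin 3)) (i : Fin N) {η : ℝ} (hη : 2 / 5 ≤ η)
    (hch : ∃ (A : EuclideanSpace ℝ (Fin 3) →ₗᵢ[ℝ] EuclideanSpace ℝ (Fin 3)) (a h : ℝ) (s : ℤ → ℤ), 47 / 50 ≤ a ∧ a ≤ 1 ∧ 39 / 50 * a ≤ h ∧ h ≤ 17 / 20 * a ∧ IsHaggSeq s ∧ (fun S : Set (EuclideanSpace ℝ (Fin 3)) => (∀ j : Fin N, dist (x j) (x i) ≤ 2 → ∃ p ∈ S, dist (x j) p ≤ 2 / 5) ∧ (∀ p ∈ S, dist p (x i) ≤ 2 → ∃ j : Fin N, dist (x j) p ≤ 2 / 5)) {p | ∃ m u v : ℤ, p = x i + A (((u : ℝ) • triangularVec₁ a) + ((v : ℝ) • triangularVec₂ a) + ((haggLabel s m : ℝ) • barlowOffset a) + ((m : ℝ) • layerNormal h))}) :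
    ∃ (A : EuclideanSpace ℝ (Fin 3) →ₗᵢ[ℝ] EuclideanSpace ℝ (Fin 3)) (t : EuclideanSpace ℝ (Fin 3)) (a : ℝ) (s : ℤ → ℤ) (z : ℤ → ℝ), 47 / 50 ≤ a ∧ a ≤ 1 ∧ IsHaggSeq s ∧ (∀ m : ℤ, 39 / 50 * a ≤ z (m + 1) - z m ∧ z (m + 1) - z m ≤ 17 / 20 * a) ∧ (fun S : Set (EuclideanSpace ℝ (Fin 3)) => (∀ j : Fin N, dist (x j) (x i) ≤ 2 → ∃ p ∈ S, dist (x j + t) p ≤ η) ∧ (∀ p ∈ S, dist p (x i + t) ≤ 2 → ∃ j : Fin N, dist (x j + t) p ≤ η)) {p | ∃ m i j : ℤ, p = A (((i : ℝ) • triangularVec₁ a) + ((j : ℝ) • triangularVec₂ a) + ((haggLabel s m : ℝ) • barlowOffset a) + (z m • layerNormal 1))} := by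
  obtain ⟨A, a, h, s, ha₁, ha₂, hh₁, hh₂, hs, h₁, h₂⟩ := hch
  refine ⟨A, -x i, a, s, fun m => (m : ℝ) * h, ha₁, ha₂, hs, fun m => ?_, fun j hj => ?_, fun p hp hd => ?_⟩
  · push_cast
    constructor <;> nlinarith
  · obtain ⟨p, ⟨m, u, v, rfl⟩, hd⟩ := h₁ j hj
    refine ⟨A (((u : ℝ) • triangularVec₁ a) + ((v : ℝ) • triangularVec₂ a) + ((haggLabel s m : ℝ) • barlowOffset a) +
      ((m : ℝ) • layerNormal h)), ⟨m, u, v, by rw [mul_smul_layerNormal_one]⟩, ?_⟩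
    rw [dist_eq_norm] at hd ⊢
    have : x j + -x i - A (((u : ℝ) • triangularVec₁ a) + ((v : ℝ) • triangularVec₂ a) +
        ((haggLabel s m : ℝ) • barlowOffset a) + ((m : ℝ) • layerNormal h)) =
        x j - (x i + A (((u : ℝ) • triangularVec₁ a) + ((v : ℝ) • triangularVec₂ a) +
        ((haggLabel s m : ℝ) • barlowOffset a) + ((m : ℝ) • layerNormal h))) := by abel
    rw [this]
    exact hd.trans hη
  · obtain ⟨m, u, v, rfl⟩ := hp
    rw [mul_smul_layerNormal_one] at hd ⊢
    set q : EuclideanSpace ℝ (Fin 3) := A (((u : ℝ) • triangularVec₁ a) + ((v : ℝ) • triangularVec₂ a) +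
      ((haggLabel s m : ℝ) • barlowOffset a) + ((m : ℝ) • layerNormal h)) with hq
    have hmem : x i + q ∈ {p | ∃ m u v : ℤ, p = x i + A (((u : ℝ) • triangularVec₁ a) + ((v : ℝ) • triangularVec₂ a) +
        ((haggLabel s m : ℝ) • barlowOffset a) + ((m : ℝ) • layerNormal h))} := ⟨m, u, v, rfl⟩
    have hd' : dist (x i + q) (x i) ≤ 2 := by
      rw [dist_eq_norm, add_sub_cancel_left]
      rw [dist_eq_norm] at hd
      have : q - (x i + -x i) = q := by abel
      rwa [this] at hd
    obtain ⟨j, hj⟩ := h₂ (x i + q) hmem hd'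
    refine ⟨j, ?_⟩
    rw [dist_eq_norm] at hj ⊢
    have : x j + -x i - q = x j - (x i + q) := by abel
    rw [this]
    exact hj.trans hη

/-! ### The coarse regime -/

/-- Counting: a predicate implied by another on `Ω` has the smaller `Nat.card`. [folklore] -/
theorem natCard_subtype_mono {N : ℕ} (Ω : Finset (Fin N)) {P Q : Fin N → Prop} (h : ∀ i ∈ Ω, P i → Q i) :
    Nat.card {i : Fin N // i ∈ Ω ∧ P i} ≤ Nat.card {i : Fin N // i ∈ Ω ∧ Q i} := by
  refine Nat.card_le_card_of_injective
    (fun p : {i : Fin N // i ∈ Ω ∧ P i} => (⟨p.1, p.2.1, h p.1 p.2.1 p.2.2⟩ : {i : Fin N // i ∈ Ω ∧ Q i})) ?_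
  intro p q hpq
  have h' : p.1 = q.1 := by
    have := congrArg (fun r : {i : Fin N // i ∈ Ω ∧ Q i} => r.1) hpq
    simpa using this
  exact Subtype.ext h'

/-- **Registered helper `stub_coarseRegime`: the crux `NearFieldConvexity` for every `η ≥ 2/5`, given the chart
core** (the registered signature of `stub_chartCore` as hypothesis; coverage, sites, interface chain and boundary
floor are landed).  Every particle of `Ω` whose `3`-ball lies in `Ω` carries a `2/5`-chart, hence is
`η`-layered; so the non-layered particles of `Ω` lie within `3 ≤ 4` of `Ωᶜ` and are absorbed by the boundary charge,
while `Σ_{i∈Ω}(e_i − e*) ≥ −C(δ)·#∂₄Ω` by the boundary floor: `c = 1`, `C = 1 + C(δ)`. [folklore] -/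
theorem stub_coarseRegime : (∀ (N : ℕ) (x : Fin N → EuclideanSpace ℝ (Fin 3)) (i : Fin N), (∀ k : Fin N, dist (x k) (x i) ≤ 3 → IsTwoShellGood (1 / 20) (47 / 50) 1 x k) → ∀ (a : ℝ) (A : EuclideanSpace ℝ (Fin 3) →ₗᵢ[ℝ] EuclideanSpace ℝ (Fin 3)) (P : Finset (EuclideanSpace ℝ (Fin 3))) (f : EuclideanSpace ℝ (Fin 3) → Fin N), 47 / 50 ≤ a → a ≤ 1 → (P = fccTwoShellPattern ∨ P = hcpTwoShellPattern) → (∀ v ∈ P, f v ≠ i ∧ dist (x (f v)) (x i + a • A v) ≤ 1 / 20 * a) → Set.InjOn f ↑P → (∀ j : Fin N, j ≠ i → dist (x j) (x i) ≤ 3 / 2 * a → ∃ v ∈ P, f v = j) → ∃ (R : EuclideanSpace ℝ (Fin 3) →ₗᵢ[ℝ] EuclideanSpace ℝ (Fin 3)) (s : ℤ → ℤ), IsHaggSeq s ∧ (∀ v ∈ P, ∃ m u w : ℤ, R (barlowPos 1 (Real.sqrt 6 / 3) s m u w) = v) ∧ (∀ m u w : ℤ, ‖barlowPos 1 (Real.sqrt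 6 / 3) s m u w‖ ≤ 3 / 2 → barlowPos 1 (Real.sqrt 6 / 3) s m u w ≠ 0 → R (barlowPos 1 (Real.sqrt 6 / 3) s m u w) ∈ P) ∧ (∀ v ∈ P, ∀ k : Fin N, dist (x k) (x (f v)) ≤ 141 / 100 → dist (x k) (x i) ≤ 2 → ∃ m u w : ℤ, dist (x k) (x i + a • A (R (barlowPos 1 (Real.sqrt 6 / 3) s m u w))) ≤ 2 / 5) ∧ (∀ v ∈ P, ∀ m u w : ℤ, ‖barlowPos 1 (Real.sqrt 6 / 3) s m u w‖ ≤ 43 / 20 → dist (R (barlowPos 1 (Real.sqrt 6 / 3) s m u w)) v ≤ 3 / 2 → ∃ k : Fin N, dist (x k) (x i + a • A (R (barlowPos 1 (Real.sqrt 6 / 3) s m u w))) ≤ 2 / 5)) → ∀ δ : ℝ, 0 < δ → ∀ η : ℝ, 2 / 5 ≤ η → ∃ c : ℝ, 0 < c ∧ ∃ C : ℝ, ∀ (N : ℕ) (x : Fin N → EuclideanSpace ℝ (Fin 3)), (∀ i j : Fin N, i ≠ j → δ ≤ dist (x i) (x j)) → ∀ Ω : Finset (Fin N), (∀ i ∈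 Ω, IsTwoShellGood (1 / 20) (47 / 50) 1 x i) → c * (Nat.card {i : Fin N // i ∈ Ω ∧ ¬ (∃ (A : EuclideanSpace ℝ (Fin 3) →ₗᵢ[ℝ] EuclideanSpace ℝ (Fin 3)) (t : EuclideanSpace ℝ (Fin 3)) (a : ℝ) (s : ℤ → ℤ) (z : ℤ → ℝ), 47 / 50 ≤ a ∧ a ≤ 1 ∧ IsHaggSeq s ∧ (∀ m : ℤ, 39 / 50 * a ≤ z (m + 1) - z m ∧ z (m + 1) - z m ≤ 17 / 20 * a) ∧ (fun S : Set (EuclideanSpace ℝ (Fin 3)) => (∀ j : Fin N, dist (x j) (x i) ≤ 2 → ∃ p ∈ S, dist (x j + t) p ≤ η) ∧ (∀ p ∈ S, dist p (x i + t) ≤ 2 → ∃ j : Fin N, dist (x j + t) p ≤ η)) {p | ∃ m i j : ℤ, p = A (((i : ℝ) • triangularVec₁ a) + ((j : ℝ) • triangularVec₂ a) + ((haggLabel s m : ℝ) • barlowOffset a) + (z m • layerNormal 1))})} : ℝ) - C * (Nat.card {i : Fin N // i ∈ Ω ∧ ∃ j : Fin N, j ∉ Ω ∧ dist (x j) (x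 i) ≤ 4} : ℝ) ≤ ∑ i ∈ Ω, ((1 / 2 : ℝ) * (∑ j ∈ Finset.univ.erase i, lennardJones (dist (x i) (x j))) - (⨅ Q : PeriodicConfiguration 3, Q.energyPerParticle lennardJones)) := by
  intro hcore δ hδ η hη
  obtain ⟨Cb, hCb⟩ := boundaryFloor interfaceLemma δ hδ
  refine ⟨1, one_pos, 1 + Cb, fun N x hsep Ω hΩ => ?_⟩
  -- every non-layered particle of `Ω` sees `Ωᶜ` within `3 ≤ 4`
  have hcount : Nat.card {i : Fin N // i ∈ Ω ∧ ¬ (∃ (A : EuclideanSpace ℝ (Fin 3) →ₗᵢ[ℝ] EuclideanSpace ℝ (Fin 3)) (t : EuclideanSpace ℝ (Fin 3)) (a : ℝ) (s : ℤ → ℤ) (z : ℤ → ℝ), 47 / 50 ≤ a ∧ a ≤ 1 ∧ IsHaggSeq s ∧ (∀ m : ℤ, 39 / 50 * a ≤ z (m + 1) - z m ∧ z (m + 1) - z m ≤ 17 / 20 * a) ∧ (fun S : Set (EuclideanSpace ℝ (Fin 3)) => (∀ j : Fin N, dist (x j) (x i) ≤ 2 → ∃ p ∈ S, dist (x j + t)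 p ≤ η) ∧ (∀ p ∈ S, dist p (x i + t) ≤ 2 → ∃ j : Fin N, dist (x j + t) p ≤ η)) {p | ∃ m i j : ℤ, p = A (((i : ℝ) • triangularVec₁ a) + ((j : ℝ) • triangularVec₂ a) + ((haggLabel s m : ℝ) • barlowOffset a) + (z m • layerNormal 1))})} ≤
      Nat.card {i : Fin N // i ∈ Ω ∧ ∃ j : Fin N, j ∉ Ω ∧ dist (x j) (x i) ≤ 4} := by
    refine natCard_subtype_mono Ω (fun i hi hNL => ?_)
    by_contra hfar
    have h3 : ∀ k : Fin N, dist (x k) (x i) ≤ (3 : ℝ) → k ∈ Ω := fun k hk => by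
      by_contra hkΩ
      exact hfar ⟨k, hkΩ, hk.trans (by norm_num)⟩
    exact hNL (layered_of_chart x i hη
      (chart_of_stubs_radius le_rfl stub_chartCoverage hcore stub_chartSites N x Ω hΩ i hi h3))
  have hcount' : (Nat.card {i : Fin N // i ∈ Ω ∧ ¬ (∃ (A : EuclideanSpace ℝ (Fin 3) →ₗᵢ[ℝ] EuclideanSpace ℝ (Fin 3)) (t : EuclideanSpace ℝ (Fin 3)) (a : ℝ) (s : ℤ → ℤ) (z : ℤ → ℝ), 47 / 50 ≤ a ∧ a ≤ 1 ∧ IsHaggSeq s ∧ (∀ m : ℤ, 39 / 50 * a ≤ z (m + 1) - z m ∧ z (m + 1) - z m ≤ 17 / 20 * a) ∧ (fun S : Set (EuclideanSpace ℝ (Fin 3)) => (∀ j : Fin N, dist (x j) (x i) ≤ 2 → ∃ p ∈ S, dist (x j + t) p ≤ η) ∧ (∀ p ∈ S, dist p (x i + t) ≤ 2 → ∃ j : Fin N, dist (x j + t) p ≤ η)) {p | ∃ m i j : ℤ, p = A (((i : ℝ) • triangularVec₁ a) + ((j : ℝ) • triangularVec₂ a) + ((haggLabel s m : ℝ) • barlowOffset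 a) + (z m • layerNormal 1))})} : ℝ) ≤
      (Nat.card {i : Fin N // i ∈ Ω ∧ ∃ j : Fin N, j ∉ Ω ∧ dist (x j) (x i) ≤ 4} : ℝ) := by
    exact_mod_cast hcount
  have hfloor := hCb N x hsep Ω hΩ
  linarith [hcount', hfloor]

end Summit.AtomisticToContinuum.Crystallization.Theorems.PhononSlackNearFieldConvexity
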